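import Summits.ABC.ABC.Theorems.PadicPrimesKummerThirdY07OddStubOrdLineG
import HarnessLib

/-!
# Cell abc-stewartyu, crux `Y07Odd` (stmt-ABC-19658), line `gen3-slab-odd`: the `Λ`-ORDER LINE from the negated bound with ANY constant `c ≥ 256`
# (the landed stub `stub_ordLineG` carries the superseded field equations `P.Nq = 1`, `P.Amax = Vmax` of the first parameter record; this is its
# record-free form used by the R21 skeleton)

`Summits/ABC/StewartYu/PadicG3OrdLine.lean` — cell `abc-stewartyu` (seat p2-g4, F-odd lead).  One theorem `G3Setup.ordLine_of_negBound`; no named fact.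

References: K. Yu, Acta Math. 211 (2013) §7.
-/

noncomputable section

open Finset

namespace Summit.ABC.StewartYu

namespace G3Setup

variable {p : ℕ} [Fact p.Prime] (S : G3Setup p)

/-- **The `Λ`-order line from the negated bound** (any constant `c ≥ 256`): `∏ αⱼ^{bⱼ} ≠ 1` and
`(m+1) + ord_p(b_{j₀}) ≤ ord_p(∏ αⱼ^{bⱼ} − 1)` for the record's `m = ⌈8(n+1)/log p − θ₀⌉`. [cite: Yu2013, §7; shape only] -/
theorem ordLine_of_negBound (hp2 : p ≠ 2) (hn2 : 2 ≤ S.n) (V : Fin S.n → ℝ) (Vmax W : ℝ)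
    (hV1 : ∀ j, 1 ≤ V j) (hVm : ∀ j, V j ≤ Vmax) (hWb : ∀ j, Real.log (max 3 (|S.b j| : ℝ)) ≤ W) (hW : 1 ≤ W)
    {c : ℝ} (hc : 256 ≤ c)
    (hU : ¬ (padicValRat p (∏ j, S.α j ^ S.b j - 1) : ℝ) * Real.log p ≤
        c ^ S.n * ((p : ℝ) / Real.log p) * (∏ j, V j) * (W + Real.log p + Real.log (2 * Vmax)))
    (P : PadicG3Par S.n) (hPp : P.p = p) :
    ∏ j, S.α j ^ S.b j ≠ 1 ∧ ((P.m + 1 : ℕ) : ℤ) + padicValInt p (S.b S.j₀) ≤ padicValRat p (∏ j, S.α j ^ S.b j - 1) := by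
  have _h2 := hp2
  have hp : p.Prime := Fact.out
  have hp3 : 3 ≤ p := by have := hp.two_le; omega
  have hpR : (3 : ℝ) ≤ p := by exact_mod_cast hp3
  have hlogp : 0 < Real.log p := Real.log_pos (by linarith)
  have hn1 : 1 ≤ S.n := by omega
  -- the right side of the bound is ≥ 256ⁿ (W + log p) ≥ W + 2 log p + 8(n+1) > 0
  have hVmax : 1 ≤ Vmax := le_trans (hV1 ⟨0, hn1⟩) (hVm ⟨0, hn1⟩)
  have hprodV : 1 ≤ ∏ j, V j := by
    calc (1 : ℝ) = ∏ _j : Fin S.n, (1 : ℝ) := by simp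
      _ ≤ ∏ j, V j := prod_le_prod (fun _ _ => zero_le_one) fun j _ => hV1 j
  have hlog2V : 0 ≤ Real.log (2 * Vmax) := Real.log_nonneg (by linarith)
  have hpl : 1 ≤ (p : ℝ) / Real.log p := by
    rw [le_div_iff₀ hlogp, one_mul]
    have := Real.log_le_sub_one_of_pos (show (0 : ℝ) < p by linarith)
    linarith
  set R : ℝ := c ^ S.n * ((p : ℝ) / Real.log p) * (∏ j, V j) * (W + Real.log p + Real.log (2 * Vmax)) with hR
  have hc0 : (0 : ℝ) ≤ c := le_trans (by norm_num) hc
  have hR1 : c ^ S.n * (W + Real.log p) ≤ R := by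
    have h256 : (0 : ℝ) ≤ c ^ S.n := by positivity
    have hWl : 0 ≤ W + Real.log p := by linarith
    calc c ^ S.n * (W + Real.log p) = c ^ S.n * 1 * 1 * (W + Real.log p) := by ring
      _ ≤ R := by
        rw [hR]
        exact mul_le_mul (mul_le_mul (mul_le_mul_of_nonneg_left hpl h256) hprodV zero_le_one (by positivity)) (by linarith)
          hWl (by positivity)
  have hR2 : W + 2 * Real.log p + 8 * (S.n + 1) ≤ R := by
    have h' := Summit.ABC.ABC.Cruxes.Y07Odd.SlabOdd.eight_mul_add_nine_le_pow hn1
    have hcn : (256 : ℝ) ^ S.n ≤ c ^ S.n := pow_le_pow_left₀ (by norm_num) hc _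
    have h : (8 : ℝ) * S.n + 9 ≤ c ^ S.n := h'.trans hcn
    have h256 : (1 : ℝ) ≤ c ^ S.n := le_trans (one_le_pow₀ (by norm_num : (1:ℝ) ≤ 256)) hcn
    -- (256ⁿ − 1) W + (256ⁿ − 2) log p ≥ 256ⁿ − 1 ≥ 8n + 8
    have hlogp3 : Real.log p ≤ p := le_trans (Real.log_le_sub_one_of_pos (by linarith)) (by linarith)
    nlinarith [mul_le_mul_of_nonneg_left hW (by linarith : (0 : ℝ) ≤ c ^ S.n - 1),
      mul_nonneg (by linarith : (0 : ℝ) ≤ c ^ S.n - 2) hlogp.le]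
  have hRpos : 0 < R := by have := hlogp; nlinarith
  -- the order `U`
  set U : ℤ := padicValRat p (∏ j, S.α j ^ S.b j - 1) with hUdef
  have hUlt : R < (U : ℝ) * Real.log p := by push Not at hU; rw [hR]; exact hU
  refine ⟨?_, ?_⟩
  · intro h1
    have hU0 : U = 0 := by rw [hUdef, h1, sub_self, padicValRat.zero]
    rw [hU0] at hUlt; push_cast at hUlt; rw [zero_mul] at hUlt
    exact absurd hUlt (not_lt.mpr hRpos.le)
  · -- `ord_p(b_{j₀}) log p ≤ W`
    set v : ℕ := padicValInt p (S.b S.j₀) with hvdef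
    have hv : (v : ℝ) * Real.log p ≤ W := by
      have hb0 : S.b S.j₀ ≠ 0 := S.bj₀_ne
      have hdvd : p ^ v ∣ (S.b S.j₀).natAbs := by rw [hvdef]; unfold padicValInt; exact pow_padicValNat_dvd
      have hle : p ^ v ≤ (S.b S.j₀).natAbs := Nat.le_of_dvd (Int.natAbs_pos.mpr hb0) hdvd
      have hleR : (p : ℝ) ^ v ≤ |(S.b S.j₀ : ℝ)| := by
        rw [← Int.cast_abs, ← Nat.cast_natAbs]; exact_mod_cast hle
      have hpv : (0 : ℝ) < (p : ℝ) ^ v := by positivity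
      calc (v : ℝ) * Real.log p = Real.log ((p : ℝ) ^ v) := by rw [Real.log_pow]
        _ ≤ Real.log |(S.b S.j₀ : ℝ)| := Real.log_le_log hpv hleR
        _ ≤ Real.log (max 3 (|S.b S.j₀| : ℝ)) := by
            rw [← Int.cast_abs]
            refine Real.log_le_log (by rw [Int.cast_abs]; exact lt_of_lt_of_le hpv hleR) ?_
            push_cast; exact le_max_right _ _
        _ ≤ W := hWb S.j₀
    -- `(m+1) log p ≤ 8(n+1) + 2 log p`
    have hm : ((P.m + 1 : ℕ) : ℝ) * Real.log p ≤ 8 * (S.n + 1) + 2 * Real.log p := by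
      have h := P.m_le
      rw [hPp] at h
      unfold Summit.ABC.StewartYu.PadicG3Par.cG at h
      push_cast
      have : (P.m : ℝ) * Real.log p ≤ 8 * (S.n + 1) + Real.log p := by
        have := mul_le_mul_of_nonneg_right h hlogp.le
        rw [add_mul, div_mul_cancel₀ _ hlogp.ne', one_mul] at this
        linarith
      nlinarith
    -- compare
    have hk : (((P.m + 1 : ℕ) : ℤ) + (v : ℤ) : ℝ) * Real.log p < (U : ℝ) * Real.log p := by
      push_cast
      have : (((P.m + 1 : ℕ) : ℝ) + v) * Real.log p ≤ R := by
        rw [add_mul]; push_cast at hm ⊢; linarith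
      push_cast at this
      linarith
    have hk' : (((P.m + 1 : ℕ) : ℤ) + (v : ℤ) : ℝ) < (U : ℝ) := lt_of_mul_lt_mul_right hk hlogp.le
    have hk'' : ((P.m + 1 : ℕ) : ℤ) + (v : ℤ) < U := by exact_mod_cast hk'
    rw [hvdef] at hk''
    exact hk''.le


end G3Setup

end Summit.ABC.StewartYu

end
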